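import Summits.QuantumFields.BalabanUV.T4Continuum.Spine.NE3.LandauProjectionB8
import HarnessLib

/-!
# NE7PointedLandauProjection — THE LANDAU PROJECTION ONTO THE POINTED GAUGE ALGEBRA: for every direction field `Y` and every unitary periodic `W` there is a skew
# periodic generator `λ` with `λ(M•z) = 0` (PINNED AT THE TOP CORNERS, `M = L^{j+1}`) such that `Y + gaugeDir W λ` is Landau relative to `W` AGAINST THE POINTED
# CLASS — step (a) of «REP WITH A FIXED TOP» (memo `t4/b2b-balaban-t4-ne7-p1-g76/TT-CURVED-LETTER.md` §7); file 13

Cell `pub-balaban`, rung (B)+1 sub-cell t4, lineage `b2b-balaban-t4-ne7-p1` (CRUX PROVER NE7 #1 = OWNER of row NE7), generation 76.  File F79 (over pub-balaban-gaps ne3's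
`Spine/NE3/LandauProjectionB8` (§1 `covLapSite_add` ∕ `covLapSite_smul` ∕ `covLapSite_add_period`, §2 `sum_hsR_gaugeDir_gaugeDir_covLapSite`, `sum_nhsNormSq_gaugeDir_eq` —
the Gram form of the test directions is the Gram form of `Δ_W`), `NE3CurvedCornerGaugeSpace.eq_zero_of_gaugeDir_eq_zero` (a corner-trivial generator with vanishing direction
is zero), `NE3LandauOrbit`, and the Riesz-vector pattern `LinearMap.BilinForm.toDual`).
WHY (memo §2∕§7).  The curved (APE) needs a representative `U^u = We^{Z}` whose gauge is PINNED at the top corners (`u(M•z) = 1`, so that `cavgIter (j+1) (U^u) = cavgIter (j+1) U`,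
`NE7TopMismatchLetters.cavgIter_gaugeAct_eq_of_pinned`); row NE3's E′ works in B8's mean-zero class `avgKernelGauges` and moves the top.  The first brick of the pointed twin is
the LANDAU PROJECTION onto the pointed gauge algebra `𝔤₀ = {μ skew, periodic, μ(M•z) = 0}`: THIS FILE proves it by the SAME finite-dimensional Gram∕Riesz argument as
`LandauProjectionB8.exists_landauB8_correction`, with a SHORTER nondegeneracy — on `𝔤₀`, `Δ_W μ = 0 ⇒ ‖D_W μ‖² = ⟨Δμ, μ⟩ = 0 ⇒ D_W μ = 0 ⇒ μ = 0` because `μ` is ALREADY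
corner-trivial (no (‡) identity, hence NO class hypothesis on `W`: unitary and periodic suffice).  The Newton update `u ↦ e^{λ}u` with such `λ` keeps `u(M•z) = 1` exactly.
What is NOT here: the sup letter of the pointed correction (the pointed twin of (HR_W) `covLapSite_sup_le_curved_uniform`) and the Newton scheme — memo §7 (b).
WHAT ([folklore]; 0 def, 0 sorry — the pointed algebra and the Gram form are built inside the proof).
§1 `eq_zero_of_covLapSite_eq_zero_pointed` — `Δ_W` is injective on `𝔤₀` (unitary periodic `W`).
§2 **`exists_pointedLandau_correction`** — `∃ λ` skew, `(N·M)`-periodic, `λ(M•z) = 0`, with `Σ_{y∈[0,NM)^d}Σ_κ hsR (Y + gaugeDir W λ)(gaugeDir W (Δ_W ν)) = 0` for every `ν ∈ 𝔤₀`.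
HONEST FRAMING (page 1): finite-dimensional linear algebra + summation by parts on OUR objects; the pointed representative with its sup member is NOT constructed; (APE) NOT proved;
NOT ONE-STEP, NOT NE7; spine 0∕9; finite T⁴ rung (B)+1 — NOT infinite volume, NOT mass gap, NOT `BetaPertH`, NOT Clay.  Continuum YM on T⁴ ⇐ BetaPertH ∧ nine spine estimates
(0/9 proved); BetaPertH ⇐ (D1) ∧ (D4) ∧ CAP+tail; G-an2-4 gates asym, D1 and NE2/3/4.
-/

set_option autoImplicit false

open scoped BigOperators Matrix Matrix.Norms.L2Operator
open NormedSpace Finset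

namespace Summit.QuantumFields.BalabanUV.T4Continuum.NE7PointedLandauProjection

open Literature.MathematicalPhysics.QuantumFieldTheory.Balaban1983to89
open B7Prop1Explicit B7Prop2Explicit MatrixNorms
open T4AveragingDeficitWall (Ad IsUnitaryCfg IsSkewDir SmallField)
open T4AveragingDeficitWallBoundary (IsPeriodicCfg periodBox mem_periodBox)
open BlockAveragePushDirGauge (gaugeDir isPeriodicDir_gaugeDir)
open NE3CovariantCalculus (hsR hsR_self hsR_comm hsR_add_left hsR_add_right)
open NE3LandauOrbit (eq_zero_of_nhsNormSq_eq_zero hsR_zero_left)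
open NE3FrameFreeDecompositionPrep (hsR_smul_left hsR_smul_right)
open NE3CurvedCornerGaugeSpace (gaugeDir_add_pi gaugeDir_smul_pi eq_zero_of_gaugeDir_eq_zero)
open PeriodicChoice (apply_wrap_eq wrap_mem_periodBox)
open NE3.PairLandauB8 (covLapSite)
open NE3.LandauProjectionB8 (covLapSite_add covLapSite_smul covLapSite_add_period sum_hsR_gaugeDir_gaugeDir_covLapSite sum_nhsNormSq_gaugeDir_eq)

noncomputable section

variable {d : ℕ} {n : Type*} [Fintype n] [DecidableEq n]

/-! ## §1 `Δ_W` is injective on the pointed gauge algebra -/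

/-- **`Δ_W` IS INJECTIVE ON THE POINTED GAUGE ALGEBRA**: `W` unitary `(N·M)`-periodic (`M ≥ 1`); a skew `(N·M)`-periodic generator `λ` with `λ(M•z) = 0` and `Δ_W λ = 0` on the
period box vanishes — `‖D_Wλ‖² = ⟨Δλ, λ⟩ = 0`, so `D_Wλ = 0`, and a corner-trivial generator with vanishing direction is zero. [folklore] -/
theorem eq_zero_of_covLapSite_eq_zero_pointed [Nonempty n] {M N : ℕ} (hM : 1 ≤ M) (hN : 1 ≤ N) {W : Site d → Fin d → (Matrix n n ℂ)ˣ}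
    (hWu : IsUnitaryCfg W) (hWP : IsPeriodicCfg W ((N * M : ℕ) : ℤ))
    {lam : Site d → Matrix n n ℂ} (hlP : ∀ (y : Site d) (i : Fin d), lam (y + ((N * M : ℕ) : ℤ) • e i) = lam y)
    (hl0 : ∀ w : Site d, lam ((M : ℤ) • w) = 0)
    (h0 : ∀ y ∈ periodBox (d := d) (N * M), covLapSite W lam y = 0) : lam = 0 := by
  have hP : 1 ≤ N * M := Nat.mul_pos (by omega) (by omega)
  -- `‖D_W λ‖² = ⟨Δλ, λ⟩ = 0`
  have hG : ∑ y ∈ periodBox (d := d) (N * M), ∑ κ : Fin d, nhsNormSq (gaugeDir W lam y κ) = 0 := by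
    rw [sum_nhsNormSq_gaugeDir_eq hP hWu hWP hlP]
    exact Finset.sum_eq_zero fun y hy => by rw [h0 y hy]; exact hsR_zero_left _
  have hbox : ∀ y ∈ periodBox (d := d) (N * M), ∀ κ : Fin d, gaugeDir W lam y κ = 0 := by
    intro y hy κ
    have h1 := (Finset.sum_eq_zero_iff_of_nonneg fun y' _ =>
      Finset.sum_nonneg fun ν _ => nhsNormSq_nonneg (gaugeDir W lam y' ν)).1 hG y hy
    have h2 := (Finset.sum_eq_zero_iff_of_nonneg fun ν _ => nhsNormSq_nonneg (gaugeDir W lam y ν)).1 h1 κ (Finset.mem_univ κ)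
    exact eq_zero_of_nhsNormSq_eq_zero h2
  have hper := isPeriodicDir_gaugeDir hWP hlP
  have hall : ∀ (y : Site d) (κ : Fin d), gaugeDir W lam y κ = 0 := by
    intro y κ
    have hw := apply_wrap_eq (g := fun y' => gaugeDir W lam y' κ) (fun y' i => hper y' i κ) y
    rw [← hw]
    exact hbox _ (wrap_mem_periodBox (N * M) hP y) κ
  exact eq_zero_of_gaugeDir_eq_zero hM hall hl0

/-! ## §2 Existence of the pointed Landau correction -/

/-- **THE LANDAU PROJECTION ONTO THE POINTED GAUGE ALGEBRA — EXISTENCE**: `W` unitary `(N·M)`-periodic (`M, N ≥ 1`); for every direction field `Y` there is a skew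
`(N·M)`-periodic generator `λ` with `λ(M•z) = 0` for all `z` such that `Y + gaugeDir W λ` is Landau against the pointed class:
`Σ_{y∈[0,NM)^d}Σ_κ hsR (Y + gaugeDir W λ)(gaugeDir W (Δ_W ν)) = 0` for every skew `(N·M)`-periodic `ν` with `ν(M•z) = 0`.  (The Riesz vector of `ν ↦ −Σ hsR Y (gaugeDir W (Δ_W ν))`
for the Gram form `Σ hsR (Δλ)(Δν)` on the finite-dimensional pointed algebra, nondegenerate by §1.) [folklore] -/
theorem exists_pointedLandau_correction [Nonempty n] {M N : ℕ} (hM : 1 ≤ M) (hN : 1 ≤ N) {W : Site d → Fin d → (Matrix n n ℂ)ˣ}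
    (hWu : IsUnitaryCfg W) (hWP : IsPeriodicCfg W ((N * M : ℕ) : ℤ)) (Y : Site d → Fin d → Matrix n n ℂ) :
    ∃ lam : Site d → Matrix n n ℂ,
      (∀ y, lam y ∈ skewAdjoint (Matrix n n ℂ)) ∧ (∀ (y : Site d) (i : Fin d), lam (y + ((N * M : ℕ) : ℤ) • e i) = lam y) ∧
      (∀ w : Site d, lam ((M : ℤ) • w) = 0) ∧
      ∀ nu : Site d → Matrix n n ℂ, (∀ y, nu y ∈ skewAdjoint (Matrix n n ℂ)) → (∀ (y : Site d) (i : Fin d), nu (y + ((N * M : ℕ) : ℤ) • e i) = nu y) →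
        (∀ w : Site d, nu ((M : ℤ) • w) = 0) →
        ∑ y ∈ periodBox (d := d) (N * M), ∑ κ : Fin d, hsR (Y y κ + gaugeDir W lam y κ) (gaugeDir W (covLapSite W nu) y κ) = 0 := by
  have hP : 1 ≤ N * M := Nat.mul_pos (by omega) (by omega)
  -- the pointed gauge algebra as a real submodule
  let S : Submodule ℝ (Site d → Matrix n n ℂ) :=
    { carrier := {mu | (∀ y, mu y ∈ skewAdjoint (Matrix n n ℂ)) ∧ (∀ (y : Site d) (i : Fin d), mu (y + ((N * M : ℕ) : ℤ) • e i) = mu y) ∧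
        ∀ w : Site d, mu ((M : ℤ) • w) = 0}
      zero_mem' := ⟨fun _ => (skewAdjoint _).zero_mem, fun _ _ => rfl, fun _ => rfl⟩
      add_mem' := by
        rintro mu nu ⟨hμs, hμP, hμ0⟩ ⟨hνs, hνP, hν0⟩
        refine ⟨fun y => (skewAdjoint _).add_mem (hμs y) (hνs y), fun y i => ?_, fun w => ?_⟩
        · simp only [Pi.add_apply, hμP, hνP]
        · simp only [Pi.add_apply, hμ0, hν0, add_zero]
      smul_mem' := by
        rintro t mu ⟨hμs, hμP, hμ0⟩
        refine ⟨fun y => skewAdjoint.smul_mem t (hμs y), fun y i => ?_, fun w => ?_⟩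
        · simp only [Pi.smul_apply, hμP]
        · simp only [Pi.smul_apply, hμ0, smul_zero] }
  have hSmem : ∀ {mu : Site d → Matrix n n ℂ}, mu ∈ S ↔
      ((∀ y, mu y ∈ skewAdjoint (Matrix n n ℂ)) ∧ (∀ (y : Site d) (i : Fin d), mu (y + ((N * M : ℕ) : ℤ) • e i) = mu y) ∧
        ∀ w : Site d, mu ((M : ℤ) • w) = 0) := fun {mu} => Iff.rfl
  -- finite-dimensional: restriction to the period box is injective
  haveI : FiniteDimensional ℝ S := by
    let res : S →ₗ[ℝ] (↥(periodBox (d := d) (N * M)) → Matrix n n ℂ) :=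
      { toFun := fun ξ y => (ξ : Site d → Matrix n n ℂ) y.1
        map_add' := fun _ _ => rfl
        map_smul' := fun _ _ => rfl }
    refine FiniteDimensional.of_injective res fun ξ ζ h => ?_
    apply Subtype.ext
    funext y
    have hξ := apply_wrap_eq (hSmem.mp ξ.2).2.1 y
    have hζ := apply_wrap_eq (hSmem.mp ζ.2).2.1 y
    rw [← hξ, ← hζ]
    exact congr_fun h ⟨_, wrap_mem_periodBox (N * M) hP y⟩
  -- the Gram form of the pointed test directions
  let G : LinearMap.BilinForm ℝ S :=
    LinearMap.mk₂ ℝ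
      (fun lam nu => ∑ y ∈ periodBox (d := d) (N * M), ∑ κ : Fin d,
        hsR (gaugeDir W (lam : Site d → Matrix n n ℂ) y κ) (gaugeDir W (covLapSite W (nu : Site d → Matrix n n ℂ)) y κ))
      (fun lam lam' nu => by
        simp only [Submodule.coe_add, gaugeDir_add_pi, hsR_add_left, Finset.sum_add_distrib])
      (fun t lam nu => by
        simp only [Submodule.coe_smul, gaugeDir_smul_pi, hsR_smul_left, Finset.mul_sum, smul_eq_mul])
      (fun lam nu nu' => by
        simp only [Submodule.coe_add, covLapSite_add, gaugeDir_add_pi, hsR_add_right, Finset.sum_add_distrib])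
      (fun t lam nu => by
        simp only [Submodule.coe_smul, covLapSite_smul, gaugeDir_smul_pi, hsR_smul_right, Finset.mul_sum, smul_eq_mul])
  have hG : ∀ lam nu : S, G lam nu = ∑ y ∈ periodBox (d := d) (N * M), ∑ κ : Fin d,
      hsR (gaugeDir W (lam : Site d → Matrix n n ℂ) y κ) (gaugeDir W (covLapSite W (nu : Site d → Matrix n n ℂ)) y κ) := fun _ _ => rfl
  -- nondegeneracy: `G λ λ = Σ‖Δλ‖²`
  have key : ∀ lam : S, G lam lam = 0 → lam = 0 := by
    intro lam h
    obtain ⟨hls, hlP, hl0⟩ := hSmem.mp lam.2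
    rw [hG, sum_hsR_gaugeDir_gaugeDir_covLapSite hP hWu hWP hlP hlP] at h
    simp only [hsR_self] at h
    have hbox : ∀ y ∈ periodBox (d := d) (N * M), covLapSite W (lam : Site d → Matrix n n ℂ) y = 0 := by
      intro y hy
      have h1 := (Finset.sum_eq_zero_iff_of_nonneg fun y' _ => nhsNormSq_nonneg (covLapSite W (lam : Site d → Matrix n n ℂ) y')).1 h y hy
      exact eq_zero_of_nhsNormSq_eq_zero h1
    exact Subtype.ext (eq_zero_of_covLapSite_eq_zero_pointed hM hN hWu hWP hlP hl0 hbox)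
  have hGnd : G.Nondegenerate := ⟨fun lam hlam => key lam (hlam lam), fun lam hlam => key lam (hlam lam)⟩
  -- the functional and its Riesz vector
  let ℓ : Module.Dual ℝ S :=
    { toFun := fun nu => -∑ y ∈ periodBox (d := d) (N * M), ∑ κ : Fin d,
        hsR (Y y κ) (gaugeDir W (covLapSite W (nu : Site d → Matrix n n ℂ)) y κ)
      map_add' := fun nu nu' => by
        simp only [Submodule.coe_add, covLapSite_add, gaugeDir_add_pi, hsR_add_right, Finset.sum_add_distrib, neg_add]
      map_smul' := fun t nu => by
        simp only [Submodule.coe_smul, covLapSite_smul, gaugeDir_smul_pi, hsR_smul_right, Finset.mul_sum, RingHom.id_apply,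
          smul_eq_mul, mul_neg] }
  set lam := (G.toDual hGnd).symm ℓ with hlam_def
  obtain ⟨hls, hlP, hl0⟩ := hSmem.mp lam.2
  refine ⟨lam, hls, hlP, hl0, fun nu hnus hnuP hnu0 => ?_⟩
  have hnu : nu ∈ S := hSmem.mpr ⟨hnus, hnuP, hnu0⟩
  have h := LinearMap.BilinForm.apply_toDual_symm_apply (hB := hGnd) ℓ ⟨nu, hnu⟩
  rw [← hlam_def, hG] at h
  have hℓ : ℓ ⟨nu, hnu⟩ = -∑ y ∈ periodBox (d := d) (N * M), ∑ κ : Fin d,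
      hsR (Y y κ) (gaugeDir W (covLapSite W nu) y κ) := rfl
  rw [hℓ] at h
  simp only [hsR_add_left, Finset.sum_add_distrib]
  linarith

end

end Summit.QuantumFields.BalabanUV.T4Continuum.NE7PointedLandauProjection
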